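import Literature.MathematicalPhysics.QuantumFieldTheory.Balaban1983to89.B9Eq3105TAtLettersNearH
import Literature.MathematicalPhysics.QuantumFieldTheory.Balaban1983to89.B9CubeLettersCovarianceL0
import Literature.MathematicalPhysics.QuantumFieldTheory.Balaban1983to89.B9Eq3104CommutatorSupport
import Literature.MathematicalPhysics.QuantumFieldTheory.Balaban1983to89.Node00.OpsYDeltaALocalAgree

/-!
# `Balaban1983to89.B9Cor36GCubeLocLetter` — THE LOCALISED, TRANSPORTED CUBE LETTER `O_□ = χ·R(u)⁻¹G_□(Ṽ)R(u)·χ` OF THE BOND SECTOR ([B9] COR. 3.6 ∕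
# SECT. C FOR `G_□ = Δ_{a,□}⁻¹` IN THE CELL's (R)-DESIGN) AND ITS TWO LOCAL-INVERSE LAWS UP TO THE DISPLAYED DEFECT — the per-cube inputs `hP1` ∕ `hdef` ∕ `hdefT`
# of `B9Thm310DeltaAIsUnitOfExpansion.eBlock_kernelFamilyBInv_GAY_of_localInverseCubes''` DISCHARGED to row data (sub-row G-B9-LETTERS, module M5.1b-G, FILE G-F2)

T. Bałaban, *Propagators for lattice gauge theories in a background field*, Commun. Math. Phys. **99** (1985) 389–434
[`Balaban1985BackgroundPropagators`, "B9"]; [4] = T. Bałaban, *Propagators and renormalization transformations for lattice gauge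
theories. II*, Commun. Math. Phys. **96** (1984) 223–250 [`Balaban1984PropagatorsII`].

statement-level skeleton of published theorems with citation tags; proofs where landed; nothing here is a claim about the
Yang–Mills mass gap

THE PRINTED LOCUS (verbatim, held `paper:balaban1985-cmp99-background-propagators`, journal page = PDF page + 388; page owner r06).  Cor. 3.6 p. 408
l. 7–9: *«If a configuration U satisfies (3.35) with O(1)Mα₀ ≦ a₁, and Ω′₀ ⊂ □ for a cube □ of the class described in this condition, then Theorems 3.1-3.3
hold for the operators G′(U), (Q′(U)G′²(U)Q′\*(U))⁻¹, G(U) constructed for the sequence {Ω′_j}»*; its proof p. 408 l. 11–14: *«Applying the gauge transformation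
u we get U′ = U^u = e^{iηA} … This implies that U′ satisfies (3.37) for the sequence {Ω′_j} with U = 1 and α₁ = O(1)Mα₀ … but all the results of these
theorems are gauge invariant, so they hold for the configuration U also»*; Sect. C p. 409 l. 1–5: *«The operators constructed for this sequence, which we
denote by G′_□(U), C_□(U) = (Q′(U)G′_□²(U)Q′\*(U))⁻¹, G_□(U), satisfy all the inequalities of Theorems 3.1–3.3 correspondingly»*; (3.87) p. 409 *«G₀ =
Σ_□ h_□G_□h_□»*; p. 410 l. 14–15: *«the operators … depend on U restricted to Ω₀(□) ⊂ □̃⁵»*; p. 414: *«DRD\* = DD\* − DPD\*»*, (3.101) *«(DPD\*hA)_μ(x) =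
h(x)(DPD\*A)_μ(x) + (P₁(∂h)A)_μ(x)»*, (3.105) *«Δ_aG₀ = I − Σ_□K(h_□)G_□h_□ − Σ_□(1 − ζ_□̃)DPD\*h_□G_□h_□ − Σ_□ζ_□̃(DPD\* − DP_□D\*)h_□G_□h_□ −
Σ_□ζ_□̃P_{□,1}(∂h_□)G_□h_□ = I − R»* — which uses `(Δ_{loc} − DP_□D*)G_□h_□ = h_□` on `supp h_□` (p. 409 l. 3–5: `G_□ = Δ_{a,□}⁻¹` on the cube sequence);
(3.26)–(3.27) p. 395; (3.28), (3.30)–(3.34) pp. 395–396 (gauge covariance, *«Δ_a(U^u) = R(u)Δ_a(U)R(u⁻¹), G(U^u) = R(u)G(U)R(u⁻¹)»* (3.34)).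

WHY THIS FILE (cell `lit-balaban`, sub-row G-B9-LETTERS; module M5.1b-G = «Cor 3.5∕3.6 for the BOND-sector cube letter G_□», the bond twin of p33's M5.1b-G′;
staged root `pub/ym-inputs/COR35G-STATEMENTS-p02.md` v1.4 §B (i)∕§D, this seat's `lit-balaban-p38/RECORD-G-B9-LETTERS-QB1-g41.md` §4).  The consumer of record,
`B9Thm310DeltaAIsUnitOfExpansion.eBlock_kernelFamilyBInv_GAY_of_localInverseCubes''` (this seat, p637175 ✓), takes per cover cube `□` an ARBITRARY letter
`O_□ : BondOpY`, a local projection letter `Pl_□` (print's `DP_□D*`) with its (3.101) commutator `P1l_□` (`hP1 : Pl_□·M_h = M_h·Pl_□ + P1l_□`), the two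
LOCAL-INVERSE LAWS UP TO DISPLAYED DEFECTS `hdef : M_h(Δ_loc(U₁) − Pl_□)O_□M_h = M_h² − E_□`, `hdefT : M_hO_□(Δ_loc(U₁) − Pl_□)M_h = M_h² − E♯_□`, and the (3.42)
block `hE`.  Print's `G_□(U)` is the operator of the CUBE's sequence `{Ω_n(□)}` (Dirichlet exterior) and reads `U` on `Ω₀(□) ⊂ □̃⁵` only, where the (3.35)
gauge `u` of ONE class cube makes `U^u = e^{iηA}` (3.37)-small; the cell's (R)-letter `B9CubeLettersBondOpsL0.GACubeY i □ parS parB V = Δ_{a,□}(V)⁻¹` (mass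
floor instead of the Dirichlet exterior) reads `V` on the whole member torus, where `U^u` is NOT small (finding (F1-B) of the staged root).  The (R)-twin of
print's construction is therefore, exactly as in the site sector (p33 `B9Cor36GpCubeLocLetter`): read the cube letter at a LOCALISED field `Ṽ` which AGREES
WITH `U^u` NEAR `□`, transport it back along `u` (print: «all the results of these theorems are gauge invariant») and cut it off near `□`:
  `O_□ := M_χ ∘ R(u)⁻¹ ∘ G_□(Ṽ) ∘ R(u) ∘ M_χ`   (`locLetterBY`; `M_χ = cutMulY (hBdY i χ)`, `R(u) = conjY (gBondY i u)` — (3.28) on bond functions),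
  `Pl_□ := R(u)⁻¹ ∘ DP_□D*(Ṽ) ∘ R(u)`       (`locProjBY`; `DP_□D* = B9Eq3105AtLetters.DPDsCubeY`),   `P1l_□ := Pl_□M_h − M_hPl_□` (`locP1BY`).
NEW IN THE BOND SECTOR (the reason the consumer was re-cut to DEFECT laws, (QB1)-B): `Δ_{a,□} = Δ_{loc,□} − DP_□D*` is NOT local — `DP_□D* = D(1 − R_□)D*` with
`R_□ = G′_□Q′*C_□Q′G′_□` ((3.25) p. 394) — so `M_h·DP_□D*(Ṽ)·(1 − M_χ)·G_□(Ṽ) ≠ 0` and the both-sided cut letter satisfies the laws only UP TO THE DEFECTS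
  `E_□  = R(u)⁻¹·M_h·DP_□D*(Ṽ)·(M_χ − 1)·G_□(Ṽ)·R(u)·M_χ·M_h`   (`locDefectBY`),
  `E♯_□ = M_h·R(u)⁻¹·G_□(Ṽ)·(M_χ − 1)·DP_□D*(Ṽ)·M_h·R(u)`     (`locDefectTBY`)
— (R)-DESIGN TERMS, NOT IN PRINT (`= 0` for print's Dirichlet `G_□` and for the un-cut record letter, `B9Eq3105AtLetters.hloc_GACubeY`); their smallness
(`e^{−δ₀·d(supp h_□, supp(1 − χ_□))}` from (3.42) for `G_□(Ṽ)` and the decay of `DR_□D*`) is the business of FILE G-F6, not of this file.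

WHAT THIS FILE PROVES (THEOREMS + five `def`s with bodies; 0 `def … : Prop`, 0 sorry).
* §1 (any ring) `localInverse_defect_abstract`, `localInverse_defectT_abstract` — the two laws for `O = CΓ⁻¹GΓC`, `Pl = Γ⁻¹P_cΓ` from: `ΓΓ⁻¹ = Γ⁻¹Γ = 1`, covariance
  `Δ = Γ⁻¹Δ′Γ`, `HΓ = ΓH`, `CΓ = ΓC`, `CH = H` (resp. `HC = H`), the ROW IDENTITY `HΔ′C = HΔ_c` (resp. `CΔ′H = Δ_cH`) and `(Δ_c − P_c)G = 1` (resp. `G(Δ_c − P_c) = 1`),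
  with the defect displayed: `H(Δ − Pl)OH = H² − Γ⁻¹HP_c(C − 1)GΓCH`, `HO(Δ − Pl)H = H² − HΓ⁻¹G(C − 1)P_cHΓ`.
* §2 (def-Y's letters) `deltaLocY_cov` ((3.30)–(3.32) assembled for `Δ_loc = Δ(U) + DD* + Q*aQ`), `deltaLocY_eq_conj`; the INPUT STENCIL `InStencilB` of a row of `Δ_loc`
  (two lattice steps around `chart f₋`, or a common bond averaging) and ★ `deltaLocY_cutMulY_apply_of_const` (`Δ_loc(U)(χ·Λ)(f) = χ(f)·(Δ_loc(U)Λ)(f)` when `χ` is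
  constant on the input stencil of `f`); ★ `deltaLocY_apply_congr_cfg` (a row of `Δ_loc` reads `U` on the plaquettes around `f`, on `f` and the divergence rows of
  its ends, and the `Q`-transporters of the averaging pairs through `f` — def-Y's `OpsYDeltaALocalAgree` pointwise congruences assembled; the guarded form reads
  only where the input is non-zero).
* §3 the two ROW IDENTITIES behind (3.105) at the localised field: ★ `cutMulY_deltaLocY_cutMulY_eq` (`M_h·Δ_loc(U′)·M_χ = M_h·Δ_{loc,□}(Ṽ)`) and ★
  `cutMulY_deltaLocY_cutMulY_eq'` (`M_χ·Δ_loc(U′)·M_h = Δ_{loc,□}(Ṽ)·M_h`) from: `χ = 1` on the input stencils of the `h`-rows (resp. of a bond set `D` containing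
  every row whose input stencil meets `supp h`), row agreement of `Δ_loc(U′)` and `Δ_loc(Ṽ)` there, and the member∕cube agreement of the averaging rows (r05
  `B9CubeBondRowAgreementNearH`, displayed here as a row hypothesis, discharged in §5 at `h_□ = hTY i □`).
* §4 THE LETTERS `locLetterBY`, `locProjBY`, `locP1BY`, `locDefectBY`, `locDefectTBY`; `locProjBY_mul_cutMulY` (`hP1`); ★★ `cutMulY_sub_locLetterBY_cutMulY`
  (`hdef`) and ★★ `cutMulY_locLetterBY_sub_cutMulY` (`hdefT`) from the gauge laws of `parS`∕`parB` (def-Y `IsGaugeLawS`∕`IsGaugeLawB`, r05 `deltaACubeY_cov`),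
  the row identities of §3, `χ·h = h`, and `IsUnit Δ_{a,□}(Ṽ)` (DISPLAYED — Cor 3.5's content for the cube letter, FILE G-F5); ★★ `localInverse_defect_laws_of_rows`.
* §5 at the partition of record `h_□ = hTY i □`: the member∕cube averaging-row agreement DISCHARGED (r05 `QsaQCubeY_apply_eq_of_hT`, this seat's
  `B9Eq3105TAtLettersNearH.QsaQCubeY_cutMulY_hT_apply_eq`): ★★★ `localInverse_defect_laws_hTY` — `hP1`, `hdef`, `hdefT` of the consumer for `O_□ = locLetterBY …`
  in the SHAPE THE CONSUMER BINDS (`Oc □ := fun _ => locLetterBY …`, U-constant), from: the two gauge laws, `IsUnit Δ_{a,□}(Ṽ)`, `χ = 1` on the input stencils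
  of the `h_□`-rows and of `D`, and the two row-agreement data `U^u ↔ Ṽ` (unguarded on the `h_□`-rows, guarded on `D`) — the geometric discharge of the last three at
  the cut-offs of record (p33's `chiY`∕`chiTY`∕`locCfgY`, F3∕F4) is FILE G-F3.

HONEST SCOPE.  Finite-dimensional operator algebra over def-Y's and r05's DEFINED operators; the letter `O_□` is the (R)-design's reading of print's `G_□(U)`
(«constructed for the sequence {Ω_n(□)}», read at the field localised to a class cube and transported back along `u`; print's Dirichlet letter needs no
localisation, no cut-off and has no defect), a function of the CHOSEN gauge `u`, localised field `Ṽ` and cut-off `χ`: NOT gauge-covariant.  DEFECT LABEL: `E_□`,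
`E♯_□` are (R)-design terms, NOT in print; `= 0` for print's `G_□ = (Δ_{loc,□} − DP_□D*)⁻¹` on the cube sequence (p. 409 l. 3–5) and for r05's un-cut `GACubeY`
(`B9Eq3105OfLocalInverse.hdef_GACubeY`).  NO estimate of [B9] is proved or used ((3.42) for `O_□` = FILES G-F4–G-F6; the defect majorant = G-F6); `IsUnit
Δ_{a,□}(Ṽ)`, the stencil conditions and the row-agreement data are HYPOTHESES here (inhabited: at `u := 1`, `Ṽ := U`, `χ := 1`, `D := univ` they reduce to r05's
row agreement — not a vacuous schema; then `E_□ = E♯_□ = 0`); count-neutral; no summit ∕ sub-problem statement is proved; nothing continuum ∕ OS ∕ mass-gap ∕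
Clay; YM mass gap NOT proved by any of this (Track A conditional rung).  No `sorry`, no `axiom`, no `… : Prop` fact, no `instance`, no `notation`.  NEW file;
nothing landed is modified.  Cell `lit-balaban`, seat `lit-balaban-p38` gen 42, 2026-08-28; `--supports stmt-QuantumFields-19200` as helper.
Net new unproved facts: 0.

RELATED IN THE TREE, NOT DUPLICATED (searched 2026-08-28: `lean search 'locLetterBY|locProjBY|locDefectBY|deltaLocY_cov|InStencilB' --decl` = ∅): p33's SITE twin
`B9Cor36GpCubeLocLetter` (`locLetterY`, exact laws — `Δ′_a` is local); def-Y's Dirichlet-compression letters `Node00.OpsYDeltaALocal.GAsqY` ∕ `…LocalAgree` (the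
print-shaped ALTERNATIVE letters, no flat (3.42) input in the tree — their pointwise congruences `hessY∕gradY∕divY∕QY∕QsY_apply_congr` ARE used by name);
r05 `B9CubeLettersBondOpsL0` (`deltaACubeY`, `GACubeY`), `B9CubeLettersCovarianceL0` (`deltaACubeY_cov`), `B9CubeBondRowAgreementNearH`; this seat's
`B9Eq3104CutoffCommutators` (`deltaLocY`, `hBdY`), `B9Eq3104CommutatorSupport` (stencil bookkeeping), `B9Eq3105AtLetters` (`DPDsCubeY`, `deltaLocCubeY`,
`hloc_GACubeY` — the un-cut, defect-free instance), `B9Eq3105OfLocalInverse` (the (3.105) algebra with defects); def-Y `Node00.OpsYGauge` (`conjY`, `gBondY`,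
`IsGaugeLawB`, `hessY_cov` …) — USED BY NAME; no existing module modified.
-/

noncomputable section

namespace Literature.MathematicalPhysics.QuantumFieldTheory.Balaban1983to89.B9Cor36GCubeLocLetter

open Node00
open B9Eq39Adjoint (R R_smul R_zero)
open B9Thm37CubeCoverCommutators (cutMulY cutMulY_apply cutMulY_mul hTY hTY_apply intw_cutMulY)
open B9Eq3104CutoffCommutators (hBdY hBdY_apply deltaLocY)
open B9Eq3104CommutatorSupport (aY_apply_eq_zero_of curv2Y_cutMulY_apply_of_const touch_symm touch_of_gradK_ne_zero touch_src_of_curlK_ne_zero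
  touch_src_edgeY touch_plaq_of_curlK_ne_zero)
open B9Eq3104CommutatorSizesAvg (aY_apply)
open B9Thm37CutoffGradTerms (torusSupNorm_sub_self_le_one)
open B9CubeLettersBondOpsL0 (QCubeY QsCubeY aCubeY deltaACubeY GACubeY deltaACubeY_mul_GACubeY GACubeY_mul_deltaACubeY)
open B9Eq3105AtLetters (DPDsCubeY deltaLocCubeY deltaACubeY_eq_loc_sub)
open B9CubeLettersCovarianceL0 (deltaACubeY_cov)
open B9CubeBondRowAgreementNearH (QsaQCubeY_apply_eq_of_hT)
open B9Eq3105TAtLettersNearH (QsaQCubeY_cutMulY_hT_apply_eq)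
open Node00.OpsYNablaBridge (chartY divK_apply)
open Node00.OpsYDeltaALocalAgree (PlaqAgreeY hessY_apply_congr gradY_apply_congr divY_apply_congr QY_apply_congr QsY_apply_congr)
open B6KLevelCensusIndexV1 (KIdx)
open B6Cover236MultiLevelBlocks (cubes)
open B4TorusKernel.MultiPeriod (torusSupNorm)
open B15DeterminingSets (embIter)
open scoped Matrix

/-! ## §1 The two laws in any ring, the defect displayed -/

section Abstract

variable {A : Type*} [Ring A]

/-- **THE LOCAL-INVERSE LAW UP TO A DEFECT, in any ring.**  Letters: `H` (`M_h`), `C` (`M_χ`), `Γ`, `Γi` (`R(u)`, `R(u)⁻¹`), `Δ` (`Δ_loc(U)`), `Δ'` (`Δ_loc(U^u)`),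
`Δc` (`Δ_{loc,□}(Ṽ)`), `Pc` (`DP_□D*(Ṽ)`), `G` (`G_□(Ṽ)`).  From `Γ⁻¹Γ = ΓΓ⁻¹ = 1`, covariance `Δ = Γ⁻¹Δ′Γ`, `HΓ = ΓH`, `CΓ = ΓC`, `CH = H`, the ROW IDENTITY
`HΔ′C = HΔ_c` and `(Δ_c − P_c)G = 1`: `H(Δ − Γ⁻¹P_cΓ)(CΓ⁻¹GΓC)H = H² − Γ⁻¹HP_c(C − 1)GΓCH`.  DEFECT LABEL: the subtracted term is an (R)-design term, NOT in print
(`= 0` when `C = 1` near the rows, i.e. for print's un-cut `G_□`). [cite: Balaban1985BackgroundPropagators, (3.105) p.414, p.409 l.3–5, (3.34) p.396, (3.87) p.409] -/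
theorem localInverse_defect_abstract (H C Γ Γi Δ Δ' Δc Pc G : A)
    (hΓ : Γi * Γ = 1) (hΓ' : Γ * Γi = 1) (hcov : Δ = Γi * Δ' * Γ) (hHΓ : H * Γ = Γ * H) (hCΓ : C * Γ = Γ * C) (hCH : C * H = H)
    (hrows : H * Δ' * C = H * Δc) (hinv : (Δc - Pc) * G = 1) :
    H * (Δ - Γi * Pc * Γ) * (C * Γi * G * Γ * C) * H = H * H - Γi * H * Pc * (C - 1) * G * Γ * C * H := by
  have hHΓi : H * Γi = Γi * H := by
    calc H * Γi = Γi * Γ * H * Γi := by rw [hΓ, one_mul]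
      _ = Γi * (Γ * H) * Γi := by simp only [mul_assoc]
      _ = Γi * (H * Γ) * Γi := by rw [hHΓ]
      _ = Γi * H * (Γ * Γi) := by simp only [mul_assoc]
      _ = Γi * H := by rw [hΓ', mul_one]
  have hΓCΓi : Γ * C * Γi = C := by rw [← hCΓ, mul_assoc, hΓ', mul_one]
  have h1 : Γi * H * Γ * C * H = H * H := by
    calc Γi * H * Γ * C * H = H * (Γi * Γ) * (C * H) := by rw [← hHΓi]; simp only [mul_assoc]
      _ = H * H := by rw [hΓ, mul_one, hCH]
  calc H * (Δ - Γi * Pc * Γ) * (C * Γi * G * Γ * C) * H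
      = H * (Γi * Δ' * Γ - Γi * Pc * Γ) * (C * Γi * G * Γ * C) * H := by rw [hcov]
    _ = (H * Γi) * (Δ' - Pc) * (Γ * C * Γi) * G * Γ * C * H := by noncomm_ring
    _ = Γi * (H * Δ' * C - H * Pc * C) * G * Γ * C * H := by rw [hHΓi, hΓCΓi]; noncomm_ring
    _ = Γi * (H * Δc - H * Pc * C) * G * Γ * C * H := by rw [hrows]
    _ = Γi * H * ((Δc - Pc) * G) * Γ * C * H + Γi * H * Pc * (1 - C) * G * Γ * C * H := by noncomm_ring
    _ = Γi * H * Γ * C * H + Γi * H * Pc * (1 - C) * G * Γ * C * H := by rw [hinv, mul_one]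
    _ = H * H + Γi * H * Pc * (1 - C) * G * Γ * C * H := by rw [h1]
    _ = H * H - Γi * H * Pc * (C - 1) * G * Γ * C * H := by noncomm_ring

/-- **THE TRANSPOSED LOCAL-INVERSE LAW UP TO A DEFECT, in any ring**: with `HC = H`, the transposed row identity `CΔ′H = Δ_cH` and `G(Δ_c − P_c) = 1`:
`H(CΓ⁻¹GΓC)(Δ − Γ⁻¹P_cΓ)H = H² − HΓ⁻¹G(C − 1)P_cHΓ` (transposed reading — bookkeeping; print displays only the left form of (3.105)).  DEFECT LABEL: the
subtracted term is an (R)-design term, NOT in print. [cite: Balaban1985BackgroundPropagators, (3.105) p.414, p.409 l.3–5, (3.34) p.396, (3.87) p.409] -/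
theorem localInverse_defectT_abstract (H C Γ Γi Δ Δ' Δc Pc G : A)
    (hΓ : Γi * Γ = 1) (hΓ' : Γ * Γi = 1) (hcov : Δ = Γi * Δ' * Γ) (hHΓ : H * Γ = Γ * H) (hCΓ : C * Γ = Γ * C) (hHC : H * C = H)
    (hrowsT : C * Δ' * H = Δc * H) (hinvT : G * (Δc - Pc) = 1) :
    H * (C * Γi * G * Γ * C) * (Δ - Γi * Pc * Γ) * H = H * H - H * Γi * G * (C - 1) * Pc * H * Γ := by
  have hΓCΓi : Γ * C * Γi = C := by rw [← hCΓ, mul_assoc, hΓ', mul_one]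
  have h2 : H * Γi * H * Γ = H * H := by
    calc H * Γi * H * Γ = H * Γi * (H * Γ) := by simp only [mul_assoc]
      _ = H * Γi * (Γ * H) := by rw [hHΓ]
      _ = H * (Γi * Γ) * H := by simp only [mul_assoc]
      _ = H * H := by rw [hΓ, mul_one]
  calc H * (C * Γi * G * Γ * C) * (Δ - Γi * Pc * Γ) * H
      = H * (C * Γi * G * Γ * C) * (Γi * Δ' * Γ - Γi * Pc * Γ) * H := by rw [hcov]
    _ = (H * C) * Γi * G * (Γ * C * Γi) * (Δ' - Pc) * (Γ * H) := by noncomm_ring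
    _ = H * Γi * G * (C * Δ' * H - C * Pc * H) * Γ := by rw [hHC, hΓCΓi, ← hHΓ]; noncomm_ring
    _ = H * Γi * G * (Δc * H - C * Pc * H) * Γ := by rw [hrowsT]
    _ = H * Γi * (G * (Δc - Pc)) * H * Γ + H * Γi * G * (1 - C) * Pc * H * Γ := by noncomm_ring
    _ = H * Γi * H * Γ + H * Γi * G * (1 - C) * Pc * H * Γ := by rw [hinvT, mul_one]
    _ = H * H + H * Γi * G * (1 - C) * Pc * H * Γ := by rw [h2]
    _ = H * H - H * Γi * G * (C - 1) * Pc * H * Γ := by noncomm_ring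

end Abstract

variable {d ℓ : ℕ} {hd : 1 ≤ d + 1} {hL : Odd (ℓ + 1) ∧ 1 < ℓ + 1} {b₀ b₁ : ℝ}
variable {𝔸 : Type} [NormedRing 𝔸] [NormedAlgebra ℂ 𝔸] [CompleteSpace 𝔸]

/-! ## §2 `Δ_loc(U)`: covariance, input stencil, background reads -/

section DeltaLoc

variable (i : KIdx d ℓ hd hL b₀ b₁)

/-- **(3.30)–(3.32) FOR `Δ_loc(U) = Δ(U) + D_UD*_U + Q*(U)aQ(U)`**: `Δ_loc(U^u)R(u) = R(u)Δ_loc(U)` on bond functions, for any contour transporter obeying the law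
(def-Y's `hessY_cov`, `gradY_cov`, `divY_cov`, `QsY_cov`, `aY_cov`, `QY_cov` assembled). [cite: Balaban1985BackgroundPropagators, (3.30)–(3.32) pp.395–396, (3.34) p.396, (3.26) p.395, p.414] -/
theorem deltaLocY_cov {parB : BondParY 𝔸 i} (hB : IsGaugeLawB i parB) (g : GaugeY 𝔸 i) (U : CfgY 𝔸 i) :
    Intw (conjY (gBondY i g)) (conjY (gBondY i g)) (deltaLocY i parB U) (deltaLocY i parB (gaugeY i g U)) := by
  unfold deltaLocY
  exact ((hessY_cov i g U).add ((gradY_cov i g U).comp (divY_cov i g U))).add ((QsY_cov g U hB).comp ((aY_cov i g).comp (QY_cov g U hB)))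

/-- **(3.34)′ AS A PRODUCT IDENTITY**: `Δ_loc(U) = R(u)⁻¹·Δ_loc(U^u)·R(u)`. [cite: Balaban1985BackgroundPropagators, (3.34) p.396, (3.26) p.395] -/
theorem deltaLocY_eq_conj {parB : BondParY 𝔸 i} (hB : IsGaugeLawB i parB) (g : GaugeY 𝔸 i) (U : CfgY 𝔸 i) :
    deltaLocY i parB U = conjY (gBondY i g)⁻¹ * deltaLocY i parB (gaugeY i g U) * conjY (gBondY i g) := by
  have hcov : deltaLocY i parB (gaugeY i g U) * conjY (gBondY i g) = conjY (gBondY i g) * deltaLocY i parB U := deltaLocY_cov i hB g U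
  have hinv : (conjY (gBondY i g)⁻¹ : Module.End ℂ (FBondY i → 𝔸)) * conjY (gBondY i g) = 1 := by
    rw [Module.End.mul_eq_comp, ← conjY_mul, inv_mul_cancel, conjY_one]; rfl
  rw [mul_assoc, hcov, ← mul_assoc, hinv, one_mul]

/-- **THE INPUT STENCIL OF A ROW OF `Δ_loc(U)`**: `f′` is read by the row of `f` through `Δ(U) + D_UD*_U` when `chart f′₋` is within two lattice steps of
`chart f₋` (the contour bonds of the plaquettes through or co-bounding `f`; the divergence rows of the two ends of `f`), or through `Q*(U)aQ(U)` when a coarse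
bond `y` averages both (`q(y, f) ≠ 0 ≠ q(y, f′)`, [4] (2.2)–(2.4)). [cite: Balaban1985BackgroundPropagators, (3.10) p.392, (3.3) p.390, (3.8) p.392, (3.12)–(3.14) p.393, (3.26) p.395; Balaban1984PropagatorsII, (2.2)–(2.4) p.224] -/
def InStencilB (f f' : FBondY i) : Prop :=
  (∃ u : SiteY i, torusSupNorm (toKT i).NB ((chartY i f.src).1 - u.1) ≤ 1 ∧ torusSupNorm (toKT i).NB (u.1 - (chartY i f'.src).1) ≤ 1) ∨
    ∃ y : IBondY i, qK i y f ≠ 0 ∧ qK i y f' ≠ 0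

omit [NormedAlgebra ℂ 𝔸] [CompleteSpace 𝔸] in
/-- a bond lies in its own input stencil. [cite: Balaban1985BackgroundPropagators, (3.26) p.395, bookkeeping] -/
theorem inStencilB_refl (f : FBondY i) : InStencilB i f f :=
  Or.inl ⟨chartY i f.src, torusSupNorm_sub_self_le_one i _, torusSupNorm_sub_self_le_one i _⟩

omit [CompleteSpace 𝔸] in
/-- a transported lift scales at `y` when its argument scales on the support of the row `M(y, ·)`. [cite: Balaban1985BackgroundPropagators, (3.3) p.390, bookkeeping] -/
theorem trLiftY_apply_eq_smul_of {X Y : Type} [Fintype X] (M : Matrix Y X ℝ) (T : Y → X → 𝔸ˣ) (c : ℂ) (Λ Λ' : X → 𝔸) (y : Y)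
    (h : ∀ x, M y x ≠ 0 → Λ x = c • Λ' x) : trLiftY M T Λ y = c • trLiftY M T Λ' y := by
  rw [trLiftY_apply, trLiftY_apply, Finset.smul_sum]
  refine Finset.sum_congr rfl fun x _ => ?_
  by_cases hM : M y x = 0
  · rw [hM, Complex.ofReal_zero, zero_smul, zero_smul, smul_zero]
  · rw [h x hM, R_smul, smul_comm]

/-- ★ **`(Δ_loc(U)(χ·Λ))(f) = χ(f₋)·(Δ_loc(U)Λ)(f)` WHEN `χ` IS CONSTANT ON THE INPUT STENCIL OF `f`** — each of the three terms `Δ(U) = D*𝒥D + Δ′₂`, `DD*`, `Q*aQ`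
reads `Λ` on that stencil only (this seat's `B9Eq3104CommutatorSupport` bookkeeping for the plaquette ∕ gradient rows, `curv2Y_cutMulY_apply_of_const` for `Δ′₂`).
[cite: Balaban1985BackgroundPropagators, (3.10) p.392, (3.26) p.395, p.414 l.1–3, (3.100)–(3.103) p.413] -/
theorem deltaLocY_cutMulY_apply_of_const (parB : BondParY 𝔸 i) (U : CfgY 𝔸 i) (χ : SiteY i → ℝ) (Λ : FBondY i → 𝔸) (f : FBondY i)
    (hc : ∀ f', InStencilB i f f' → χ (chartY i f'.src) = χ (chartY i f.src)) :
    deltaLocY i parB U (cutMulY (hBdY i χ) Λ) f = ((χ (chartY i f.src) : ℝ) : ℂ) • deltaLocY i parB U Λ f := by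
  set c : ℂ := ((χ (chartY i f.src) : ℝ) : ℂ) with hcdef
  -- two-step reads: `Λ′ = χ·Λ` equals `c • Λ` at every bond one step from a site one step from `chart f₋`
  have two : ∀ (u : SiteY i) (f' : FBondY i), torusSupNorm (toKT i).NB ((chartY i f.src).1 - u.1) ≤ 1 →
      torusSupNorm (toKT i).NB (u.1 - (chartY i f'.src).1) ≤ 1 → cutMulY (hBdY i χ) Λ f' = c • Λ f' := by
    intro u f' h1 h2
    rw [cutMulY_apply, hBdY_apply, hc f' (Or.inl ⟨u, h1, h2⟩)]
  -- (1) the curl of `χ·Λ` on a plaquette co-bounding `f`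
  have hcurl : ∀ p : PlaqY i, cocurlK i f p ≠ 0 → curlY i U (cutMulY (hBdY i χ) Λ) p = c • curlY i U Λ p := by
    intro p hp
    have hp' : curlK i p f ≠ 0 := by rwa [cocurlK_eq_transpose, Matrix.transpose_apply] at hp
    exact trLiftY_apply_eq_smul_of (curlK i) _ c _ _ p fun b hb =>
      two (chartY i p.src) b (touch_plaq_of_curlK_ne_zero i hp') (touch_src_of_curlK_ne_zero i hb)
  have hjor : ∀ p : PlaqY i, cocurlK i f p ≠ 0 →
      jordanY i U (curlY i U (cutMulY (hBdY i χ) Λ)) p = c • jordanY i U (curlY i U Λ) p := by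
    intro p hp
    rw [jordanY_apply, jordanY_apply, hcurl p hp, smul_mul_assoc, mul_smul_comm, ← smul_add, smul_comm]
  have e1 : coCurlY i U (jordanY i U (curlY i U (cutMulY (hBdY i χ) Λ))) f = c • coCurlY i U (jordanY i U (curlY i U Λ)) f :=
    trLiftY_apply_eq_smul_of (cocurlK i) _ c _ _ f fun p hp => hjor p hp
  -- (2) `Δ′₂`
  have e2 : curv2Y i U (cutMulY (hBdY i χ) Λ) f = c • curv2Y i U Λ f :=
    curv2Y_cutMulY_apply_of_const i U χ Λ f fun p m l hm =>
      hc _ (Or.inl ⟨chartY i p.src, by rw [← hm]; exact touch_symm i (touch_src_edgeY i p m), touch_src_edgeY i p l⟩)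
  -- (3) `DD*`
  have hdiv : ∀ z : SiteY i, gradK i f z ≠ 0 → divY i U (cutMulY (hBdY i χ) Λ) z = c • divY i U Λ z := by
    intro z hz
    exact trLiftY_apply_eq_smul_of (divK i) _ c _ _ z fun b hb =>
      two z b (touch_of_gradK_ne_zero i hz) (by rw [divK_apply] at hb; exact touch_symm i (touch_of_gradK_ne_zero i hb))
  have e3 : gradY i U (divY i U (cutMulY (hBdY i χ) Λ)) f = c • gradY i U (divY i U Λ) f :=
    trLiftY_apply_eq_smul_of (gradK i) _ c _ _ f fun z hz => hdiv z hz
  -- (4) `Q*aQ`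
  have hQ : ∀ y : IBondY i, qK i y f ≠ 0 → QY i parB U (cutMulY (hBdY i χ) Λ) y = c • QY i parB U Λ y := by
    intro y hy
    exact trLiftY_apply_eq_smul_of (qK i) _ c _ _ y fun b hb => by rw [cutMulY_apply, hBdY_apply, hc b (Or.inr ⟨y, hy, hb⟩)]
  have e4 : QsY i parB U (aY i (QY i parB U (cutMulY (hBdY i χ) Λ))) f = c • QsY i parB U (aY i (QY i parB U Λ)) f := by
    rw [QsY_eq_transpose]
    exact trLiftY_apply_eq_smul_of (qK i)ᵀ _ c _ _ f fun y hy => by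
      rw [Matrix.transpose_apply] at hy
      rw [aY_apply, aY_apply, hQ y hy, smul_comm]
  simp only [deltaLocY, hessY, LinearMap.add_apply, Pi.add_apply, LinearMap.coe_comp, Function.comp_apply]
  rw [e1, e2, e3, e4, ← smul_add, ← smul_add, ← smul_add]

/-- ★ **A ROW OF `Δ_loc` READS `U` LOCALLY (guarded form)**: `(Δ_loc(U)Λ)(f) = (Δ_loc(U′)Λ)(f)` whenever `U = U′` on the edges of the plaquettes through or
co-bounding `f`, on `f` itself, on the bonds of the divergence rows of the ends of `f` WHERE `Λ ≠ 0`, and the `Q`-transporters `U(Γ_{x(y),·})`, `U′(Γ_{x(y),·})`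
agree at `f₋` and at the initial points of the bonds `b` averaged together with `f` WHERE `Λ(b) ≠ 0` (def-Y's `OpsYDeltaALocalAgree` pointwise congruences assembled).
[cite: Balaban1985BackgroundPropagators, p.410 l.14–15, (3.10) p.392, (3.3) p.390, (3.8) p.392, (3.12)–(3.14) p.393, (3.26) p.395] -/
theorem deltaLocY_apply_congr_cfg (parB : BondParY 𝔸 i) {U U' : CfgY 𝔸 i} (Λ : FBondY i → 𝔸) (f : FBondY i)
    (hpl : ∀ p, (cocurlK i f p ≠ 0 ∨ ∃ m, edgeY i p m = f) → PlaqAgreeY i U U' p)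
    (hb : U f.dir f.src = U' f.dir f.src)
    (hdv : ∀ (z : SiteY i) (b : FBondY i), gradK i f z ≠ 0 → divK i z b ≠ 0 → Λ b ≠ 0 → U b.dir b.src = U' b.dir b.src)
    (hqo : ∀ y : IBondY i, qK i y f ≠ 0 → parB U (embIter (y.1.1 : ℕ) y.1.2.src) f.src = parB U' (embIter (y.1.1 : ℕ) y.1.2.src) f.src)
    (hqi : ∀ (y : IBondY i) (b : FBondY i), qK i y f ≠ 0 → qK i y b ≠ 0 → Λ b ≠ 0 →
      parB U (embIter (y.1.1 : ℕ) y.1.2.src) b.src = parB U' (embIter (y.1.1 : ℕ) y.1.2.src) b.src) :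
    deltaLocY i parB U Λ f = deltaLocY i parB U' Λ f := by
  simp only [deltaLocY, LinearMap.add_apply, Pi.add_apply, LinearMap.coe_comp, Function.comp_apply]
  rw [hessY_apply_congr hpl Λ,
    gradY_apply_congr hb (Λ := divY i U Λ) (Λ' := divY i U' Λ) fun z hz =>
      divY_apply_congr fun b hb' => ⟨rfl, fun hΛ => hdv z b hz hb' hΛ⟩,
    QsY_apply_congr (v := aY i (QY i parB U Λ)) (v' := aY i (QY i parB U' Λ)) fun y hy =>
      ⟨by rw [aY_apply, aY_apply, QY_apply_congr fun b hb' => ⟨rfl, fun hΛ => hqi y b hy hb' hΛ⟩], hqo y hy⟩]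

/-- the unguarded form: agreement on all the reads of the row, for every input. [cite: Balaban1985BackgroundPropagators, p.410 l.14–15, (3.26) p.395] -/
theorem deltaLocY_apply_congr_cfg' (parB : BondParY 𝔸 i) {U U' : CfgY 𝔸 i} (f : FBondY i)
    (hpl : ∀ p, (cocurlK i f p ≠ 0 ∨ ∃ m, edgeY i p m = f) → PlaqAgreeY i U U' p)
    (hb : U f.dir f.src = U' f.dir f.src)
    (hdv : ∀ (z : SiteY i) (b : FBondY i), gradK i f z ≠ 0 → divK i z b ≠ 0 → U b.dir b.src = U' b.dir b.src)
    (hq : ∀ (y : IBondY i) (b : FBondY i), qK i y f ≠ 0 → qK i y b ≠ 0 →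
      parB U (embIter (y.1.1 : ℕ) y.1.2.src) b.src = parB U' (embIter (y.1.1 : ℕ) y.1.2.src) b.src) (Λ : FBondY i → 𝔸) :
    deltaLocY i parB U Λ f = deltaLocY i parB U' Λ f :=
  deltaLocY_apply_congr_cfg i parB Λ f hpl hb (fun z b hz hb' _ => hdv z b hz hb') (fun y hy => hq y f hy hy) fun y b hy hb' _ => hq y b hy hb'

end DeltaLoc

/-! ## §3 The two row identities behind (3.105) at the localised field -/

section Rows

variable (i : KIdx d ℓ hd hL b₀ b₁) (c : ↥(cubes i.D.toDomains)) (parB : BondParY 𝔸 i)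

/-- the cube letter's local part differs from the member's only in the averaging rows. [cite: Balaban1985BackgroundPropagators, (3.26) p.395, p.409 l.1–5, bookkeeping] -/
theorem deltaLocCubeY_apply_eq_of_row (V : CfgY 𝔸 i) (Λ : FBondY i → 𝔸) (f : FBondY i)
    (h : QsY i parB V (aY i (QY i parB V Λ)) f = QsCubeY i c parB V (aCubeY i c (QCubeY i c parB V Λ)) f) :
    deltaLocCubeY i c parB V Λ f = deltaLocY i parB V Λ f := by
  simp only [deltaLocCubeY, deltaLocY, LinearMap.add_apply, Pi.add_apply, LinearMap.coe_comp, Function.comp_apply, h]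

/-- ★ **`M_h·Δ_loc(U′)·M_χ = M_h·Δ_{loc,□}(Ṽ)`** — on the rows of `supp h`: the cut-off `χ` is invisible (it is `1` on their input stencils, `hχ`), `U′` and `Ṽ`
give the same rows (`hrow`), and the member's averaging rows ARE the cube sequence's there (`hnear`, r05's row agreement near `□`).  Print: `(Δ_{loc} −
DP_□D*)G_□h_□ = h_□` uses exactly these rows. [cite: Balaban1985BackgroundPropagators, (3.105) p.414, (3.26) p.395, p.409 l.3–5, p.410 l.14–15] -/
theorem cutMulY_deltaLocY_cutMulY_eq (U' V : CfgY 𝔸 i) (h χ : SiteY i → ℝ)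
    (hχ : ∀ f : FBondY i, h (chartY i f.src) ≠ 0 → ∀ f', InStencilB i f f' → χ (chartY i f'.src) = 1)
    (hrow : ∀ f : FBondY i, h (chartY i f.src) ≠ 0 → ∀ Λ, deltaLocY i parB U' Λ f = deltaLocY i parB V Λ f)
    (hnear : ∀ f : FBondY i, h (chartY i f.src) ≠ 0 → ∀ Λ,
      QsY i parB V (aY i (QY i parB V Λ)) f = QsCubeY i c parB V (aCubeY i c (QCubeY i c parB V Λ)) f) :
    cutMulY (hBdY i h) * deltaLocY i parB U' * cutMulY (hBdY i χ) = cutMulY (hBdY i h) * deltaLocCubeY i c parB V := by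
  refine LinearMap.ext fun Λ => funext fun f => ?_
  rw [Module.End.mul_apply, Module.End.mul_apply, Module.End.mul_apply, cutMulY_apply, cutMulY_apply, hBdY_apply]
  by_cases hf : h (chartY i f.src) = 0
  · rw [hf, Complex.ofReal_zero, zero_smul, zero_smul]
  · congr 1
    have h1 : χ (chartY i f.src) = 1 := hχ f hf f (inStencilB_refl i f)
    rw [deltaLocY_cutMulY_apply_of_const i parB U' χ Λ f (fun f' hf' => by rw [hχ f hf f' hf', h1]), h1, Complex.ofReal_one, one_smul,
      hrow f hf Λ, deltaLocCubeY_apply_eq_of_row i c parB V Λ f (hnear f hf Λ)]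

/-- ★ **`M_χ·Δ_loc(U′)·M_h = Δ_{loc,□}(Ṽ)·M_h`** — for the transposed law: a row of `Δ_loc(U′)·M_h` (or of `Δ_{loc,□}(Ṽ)·M_h`) at `f` vanishes unless the input stencil of
`f` meets `supp h` (`hD`); on such rows `χ = 1` (`hχD`) and the two backgrounds give the same row on inputs `h·Λ` (`hrowD`, guarded); the member ∕ cube averaging rows
agree on inputs `h·Λ` everywhere (`hnearT`, r05). [cite: Balaban1985BackgroundPropagators, (3.105) p.414, (3.26) p.395, p.409 l.3–5, p.410 l.14–15] -/
theorem cutMulY_deltaLocY_cutMulY_eq' (U' V : CfgY 𝔸 i) (h χ : SiteY i → ℝ) (D : Finset (FBondY i))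
    (hD : ∀ f f' : FBondY i, InStencilB i f f' → h (chartY i f'.src) ≠ 0 → f ∈ D) (hχD : ∀ f ∈ D, χ (chartY i f.src) = 1)
    (hrowD : ∀ f ∈ D, ∀ Λ, deltaLocY i parB U' (cutMulY (hBdY i h) Λ) f = deltaLocY i parB V (cutMulY (hBdY i h) Λ) f)
    (hnearT : ∀ (f : FBondY i) (Λ : FBondY i → 𝔸), QsY i parB V (aY i (QY i parB V (cutMulY (hBdY i h) Λ))) f =
      QsCubeY i c parB V (aCubeY i c (QCubeY i c parB V (cutMulY (hBdY i h) Λ))) f) :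
    cutMulY (hBdY i χ) * deltaLocY i parB U' * cutMulY (hBdY i h) = deltaLocCubeY i c parB V * cutMulY (hBdY i h) := by
  refine LinearMap.ext fun Λ => funext fun f => ?_
  rw [Module.End.mul_apply, Module.End.mul_apply, Module.End.mul_apply, cutMulY_apply, hBdY_apply,
    deltaLocCubeY_apply_eq_of_row i c parB V _ f (hnearT f Λ)]
  by_cases hf : f ∈ D
  · rw [hχD f hf, Complex.ofReal_one, one_smul, hrowD f hf Λ]
  · -- the input stencil of `f` misses `supp h`: both rows vanish on `h·Λ`
    have h0 : ∀ f', InStencilB i f f' → h (chartY i f'.src) = 0 := fun f' hf' => by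
      by_contra hne
      exact hf (hD f f' hf' hne)
    have hff : h (chartY i f.src) = 0 := h0 f (inStencilB_refl i f)
    have hc : ∀ f', InStencilB i f f' → h (chartY i f'.src) = h (chartY i f.src) := fun f' hf' => by rw [h0 f' hf', hff]
    rw [deltaLocY_cutMulY_apply_of_const i parB U' h Λ f hc, deltaLocY_cutMulY_apply_of_const i parB V h Λ f hc, hff, Complex.ofReal_zero, zero_smul,
      zero_smul, smul_zero]

end Rows

/-! ## §4 The localised, transported, cut-off cube letter of the bond sector; its two local-inverse laws up to the defect -/

section Letter

variable (i : KIdx d ℓ hd hL b₀ b₁) (c : ↥(cubes i.D.toDomains)) (parS : SiteParY 𝔸 i) (parB : BondParY 𝔸 i)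

/-- ★ **THE LOCALISED CUBE LETTER OF THE (R)-DESIGN, BOND SECTOR**: `O_□ := M_χ ∘ R(u)⁻¹ ∘ G_□(Ṽ) ∘ R(u) ∘ M_χ` — r05's `G_□ = Δ_{a,□}⁻¹` READ AT a field `Ṽ` (meant:
the (3.35)-gauged field `U^u` localised to its class cube — print's «U′ = U^u = e^{iηA}» on `Ω₀(□)`), TRANSPORTED BACK along the gauge `u` ((3.28) on bond functions:
`R(u) = conjY (gBondY i u)`) and CUT OFF by a scalar `χ` read at `b₋`.  A function of the chosen `u`, `Ṽ`, `χ`; print's `G_□(U)` (cube sequence, Dirichlet exterior)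
needs none of the three devices. [cite: Balaban1985BackgroundPropagators, Cor. 3.6 p.408 l.3–14, p.409 l.1–5 («G_□(U)»), (3.34) p.396, (3.87) p.409] -/
def locLetterBY (g : GaugeY 𝔸 i) (χ : SiteY i → ℝ) (V : CfgY 𝔸 i) : (FBondY i → 𝔸) →ₗ[ℂ] (FBondY i → 𝔸) :=
  cutMulY (hBdY i χ) * conjY (gBondY i g)⁻¹ * GACubeY i c parS parB V * conjY (gBondY i g) * cutMulY (hBdY i χ)

/-- **THE TRANSPORTED LOCAL PROJECTION LETTER `Pl_□ := R(u)⁻¹ ∘ DP_□D*(Ṽ) ∘ R(u)`** (print's `DP_□D*` of (3.105), read at the localised field and transported back).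
[cite: Balaban1985BackgroundPropagators, (3.105) p.414, (3.25) p.394, (3.34) p.396] -/
def locProjBY (g : GaugeY 𝔸 i) (V : CfgY 𝔸 i) : (FBondY i → 𝔸) →ₗ[ℂ] (FBondY i → 𝔸) :=
  conjY (gBondY i g)⁻¹ * DPDsCubeY i c parS V * conjY (gBondY i g)

/-- **ITS (3.101) COMMUTATOR `P1l_□ := Pl_□M_h − M_hPl_□`** (so that `Pl_□M_h = M_hPl_□ + P1l_□` is an identity). [cite: Balaban1985BackgroundPropagators, (3.101) p.414] -/
def locP1BY (g : GaugeY 𝔸 i) (h : SiteY i → ℝ) (V : CfgY 𝔸 i) : (FBondY i → 𝔸) →ₗ[ℂ] (FBondY i → 𝔸) :=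
  locProjBY i c parS g V * cutMulY (hBdY i h) - cutMulY (hBdY i h) * locProjBY i c parS g V

/-- **THE DEFECT `E_□ := R(u)⁻¹·M_h·DP_□D*(Ṽ)·(M_χ − 1)·G_□(Ṽ)·R(u)·M_χ·M_h`** of the left law.  DEFECT LABEL: an (R)-design term, NOT in print; `= 0` for print's
`G_□ = (Δ_{loc,□} − DP_□D*)⁻¹` on the cube sequence (p. 409 l. 3–5) and for r05's un-cut `GACubeY` (`χ = 1`). [cite: Balaban1985BackgroundPropagators, (3.105) p.414, p.409 l.3–5] -/
def locDefectBY (g : GaugeY 𝔸 i) (χ h : SiteY i → ℝ) (V : CfgY 𝔸 i) : (FBondY i → 𝔸) →ₗ[ℂ] (FBondY i → 𝔸) :=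
  conjY (gBondY i g)⁻¹ * cutMulY (hBdY i h) * DPDsCubeY i c parS V * (cutMulY (hBdY i χ) - 1) * GACubeY i c parS parB V * conjY (gBondY i g) *
    cutMulY (hBdY i χ) * cutMulY (hBdY i h)

/-- **THE DEFECT `E♯_□ := M_h·R(u)⁻¹·G_□(Ṽ)·(M_χ − 1)·DP_□D*(Ṽ)·M_h·R(u)`** of the transposed law.  DEFECT LABEL: an (R)-design term, NOT in print; `= 0` for print's
letters and for r05's un-cut `GACubeY`. [cite: Balaban1985BackgroundPropagators, (3.105) p.414, p.409 l.3–5] -/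
def locDefectTBY (g : GaugeY 𝔸 i) (χ h : SiteY i → ℝ) (V : CfgY 𝔸 i) : (FBondY i → 𝔸) →ₗ[ℂ] (FBondY i → 𝔸) :=
  cutMulY (hBdY i h) * conjY (gBondY i g)⁻¹ * GACubeY i c parS parB V * (cutMulY (hBdY i χ) - 1) * DPDsCubeY i c parS V * cutMulY (hBdY i h) *
    conjY (gBondY i g)

/-- `O_□`, unfolded. [cite: Balaban1985BackgroundPropagators, p.409 l.1–5, bookkeeping] -/
theorem locLetterBY_def (g : GaugeY 𝔸 i) (χ : SiteY i → ℝ) (V : CfgY 𝔸 i) :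
    locLetterBY i c parS parB g χ V = cutMulY (hBdY i χ) * conjY (gBondY i g)⁻¹ * GACubeY i c parS parB V * conjY (gBondY i g) * cutMulY (hBdY i χ) :=
  rfl

/-- **(3.101) for `Pl_□` as an operator identity** (the consumer's `hP1`): `Pl_□·M_h = M_h·Pl_□ + P1l_□`. [cite: Balaban1985BackgroundPropagators, (3.101) p.414] -/
theorem locProjBY_mul_cutMulY (g : GaugeY 𝔸 i) (h : SiteY i → ℝ) (V : CfgY 𝔸 i) :
    locProjBY i c parS g V * cutMulY (hBdY i h) = cutMulY (hBdY i h) * locProjBY i c parS g V + locP1BY i c parS g h V := by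
  rw [locP1BY]; abel

omit [CompleteSpace 𝔸] in
/-- `R(u⁻¹)R(u) = 1` on a carrier. [cite: Balaban1985BackgroundPropagators, (3.31) p.395, bookkeeping] -/
theorem conjY_inv_mul_conjY_eq_one {X : Type} (γ : X → 𝔸ˣ) : (conjY γ⁻¹ : Module.End ℂ (X → 𝔸)) * conjY γ = 1 := by
  rw [Module.End.mul_eq_comp, ← conjY_mul, inv_mul_cancel, conjY_one]; rfl

omit [CompleteSpace 𝔸] in
/-- `R(u)R(u⁻¹) = 1` on a carrier. [cite: Balaban1985BackgroundPropagators, (3.31) p.395, bookkeeping] -/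
theorem conjY_mul_conjY_inv_eq_one {X : Type} (γ : X → 𝔸ˣ) : (conjY γ : Module.End ℂ (X → 𝔸)) * conjY γ⁻¹ = 1 := by
  rw [Module.End.mul_eq_comp, ← conjY_mul, mul_inv_cancel, conjY_one]; rfl

omit [CompleteSpace 𝔸] in
/-- a real cut-off commutes with `R(u)` (this seat's `intw_cutMulY`, as a product identity on a carrier). [cite: Balaban1985BackgroundPropagators, (3.28) p.395, bookkeeping] -/
theorem cutMulY_mul_conjY_eq {X : Type} (γ : X → 𝔸ˣ) (χ : X → ℝ) :
    (cutMulY χ : Module.End ℂ (X → 𝔸)) * conjY γ = conjY γ * cutMulY χ :=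
  intw_cutMulY γ χ

omit [CompleteSpace 𝔸] in
/-- `M_χ·M_h = M_h` when `χ·h = h` pointwise (cut-offs read at `b₋`). [cite: Balaban1985BackgroundPropagators, (3.87) p.409, p.415 («ζ_□̃h_□ = h_□»), bookkeeping] -/
theorem cutMulY_hBdY_mul_of_eq (χ h : SiteY i → ℝ) (hχh : ∀ z, χ z * h z = h z) :
    cutMulY (𝔸 := 𝔸) (hBdY i χ) * cutMulY (hBdY i h) = cutMulY (hBdY i h) := by
  rw [cutMulY_mul]
  exact congrArg _ (funext fun b => hχh _)

omit [CompleteSpace 𝔸] in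
/-- `M_h·M_χ = M_h` when `χ·h = h` pointwise. [cite: Balaban1985BackgroundPropagators, (3.87) p.409, p.415, bookkeeping] -/
theorem cutMulY_hBdY_mul_of_eq' (χ h : SiteY i → ℝ) (hχh : ∀ z, χ z * h z = h z) :
    cutMulY (𝔸 := 𝔸) (hBdY i h) * cutMulY (hBdY i χ) = cutMulY (hBdY i h) := by
  rw [cutMulY_mul]
  exact congrArg _ (funext fun b => (mul_comm _ _).trans (hχh _))

/-- ★★ **THE LOCAL-INVERSE LAW UP TO THE DEFECT, `M_h·(Δ_loc(U) − Pl_□)·O_□·M_h = M_h² − E_□`** (the consumer's `hdef`) for the localised bond letter, from: the gauge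
law of `parB` (covariance of `Δ_loc`), the row identity of §3 at `U′ = U^u` (`hrows`), `χ·h = h`, and `Δ_{a,□}(Ṽ)G_□(Ṽ) = 1` (`IsUnit Δ_{a,□}(Ṽ)`, displayed).
DEFECT LABEL: `E_□` is an (R)-design term, NOT in print. [cite: Balaban1985BackgroundPropagators, (3.105) p.414, Cor. 3.6 p.408 l.11–14, (3.34) p.396, p.409 l.3–5, (3.87) p.409] -/
theorem cutMulY_sub_locLetterBY_cutMulY {parB : BondParY 𝔸 i} (hB : IsGaugeLawB i parB) (g : GaugeY 𝔸 i) (U V : CfgY 𝔸 i) (χ h : SiteY i → ℝ)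
    (hχh : ∀ z, χ z * h z = h z)
    (hrows : cutMulY (hBdY i h) * deltaLocY i parB (gaugeY i g U) * cutMulY (hBdY i χ) = cutMulY (hBdY i h) * deltaLocCubeY i c parB V)
    (hunit : IsUnit (deltaACubeY i c parS parB V)) :
    cutMulY (hBdY i h) * (deltaLocY i parB U - locProjBY i c parS g V) * locLetterBY i c parS parB g χ V * cutMulY (hBdY i h) =
      cutMulY (hBdY i h) * cutMulY (hBdY i h) - locDefectBY i c parS parB g χ h V := by
  have hinv : (deltaLocCubeY i c parB V - DPDsCubeY i c parS V) * GACubeY i c parS parB V = 1 := by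
    rw [← deltaACubeY_eq_loc_sub]; exact deltaACubeY_mul_GACubeY i c hunit
  exact localInverse_defect_abstract (cutMulY (hBdY i h)) (cutMulY (hBdY i χ)) (conjY (gBondY i g)) (conjY (gBondY i g)⁻¹)
    (deltaLocY i parB U) (deltaLocY i parB (gaugeY i g U)) (deltaLocCubeY i c parB V) (DPDsCubeY i c parS V) (GACubeY i c parS parB V)
    (conjY_inv_mul_conjY_eq_one _) (conjY_mul_conjY_inv_eq_one _) (deltaLocY_eq_conj i hB g U) (cutMulY_mul_conjY_eq _ _) (cutMulY_mul_conjY_eq _ _)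
    (cutMulY_hBdY_mul_of_eq i χ h hχh) hrows hinv

/-- ★★ **THE TRANSPOSED LAW UP TO THE DEFECT, `M_h·O_□·(Δ_loc(U) − Pl_□)·M_h = M_h² − E♯_□`** (the consumer's `hdefT`), from: the gauge law of `parB`, the transposed
row identity of §3 at `U′ = U^u` (`hrowsT`), `h·χ = h`, and `G_□(Ṽ)Δ_{a,□}(Ṽ) = 1`.  DEFECT LABEL: `E♯_□` is an (R)-design term, NOT in print (transposed reading —
bookkeeping; print displays only the left form of (3.105)). [cite: Balaban1985BackgroundPropagators, (3.105) p.414, Cor. 3.6 p.408 l.11–14, (3.34) p.396, p.409 l.3–5] -/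
theorem cutMulY_locLetterBY_sub_cutMulY {parB : BondParY 𝔸 i} (hB : IsGaugeLawB i parB) (g : GaugeY 𝔸 i) (U V : CfgY 𝔸 i) (χ h : SiteY i → ℝ)
    (hχh : ∀ z, χ z * h z = h z)
    (hrowsT : cutMulY (hBdY i χ) * deltaLocY i parB (gaugeY i g U) * cutMulY (hBdY i h) = deltaLocCubeY i c parB V * cutMulY (hBdY i h))
    (hunit : IsUnit (deltaACubeY i c parS parB V)) :
    cutMulY (hBdY i h) * locLetterBY i c parS parB g χ V * (deltaLocY i parB U - locProjBY i c parS g V) * cutMulY (hBdY i h) =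
      cutMulY (hBdY i h) * cutMulY (hBdY i h) - locDefectTBY i c parS parB g χ h V := by
  have hinvT : GACubeY i c parS parB V * (deltaLocCubeY i c parB V - DPDsCubeY i c parS V) = 1 := by
    rw [← deltaACubeY_eq_loc_sub]; exact GACubeY_mul_deltaACubeY i c hunit
  exact localInverse_defectT_abstract (cutMulY (hBdY i h)) (cutMulY (hBdY i χ)) (conjY (gBondY i g)) (conjY (gBondY i g)⁻¹)
    (deltaLocY i parB U) (deltaLocY i parB (gaugeY i g U)) (deltaLocCubeY i c parB V) (DPDsCubeY i c parS V) (GACubeY i c parS parB V)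
    (conjY_inv_mul_conjY_eq_one _) (conjY_mul_conjY_inv_eq_one _) (deltaLocY_eq_conj i hB g U) (cutMulY_mul_conjY_eq _ _) (cutMulY_mul_conjY_eq _ _)
    (cutMulY_hBdY_mul_of_eq' i χ h hχh) hrowsT hinvT

/-- ★★ **BOTH LAWS UP TO THE DEFECTS, FROM ROW DATA** — the per-cube `hdef`∕`hdefT` of the consumer for the localised letter: given the gauge law of `parB`, `χ = 1` on
the input stencils of the `h`-rows (`hχ`) and of a bond set `D` containing every row whose input stencil meets `supp h` (`hD`, `hχD`), the row agreement of `Δ_loc(U^u)`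
and `Δ_loc(Ṽ)` (unguarded on the `h`-rows, `hrow`; on inputs `h·Λ` on `D`, `hrowD`), the member ∕ cube averaging-row agreement (`hnear`, `hnearT`) and
`Δ_{a,□}(Ṽ)` invertible.  DEFECT LABEL: `E_□`, `E♯_□` are (R)-design terms, NOT in print. [cite: Balaban1985BackgroundPropagators, (3.105) p.414, Cor. 3.6 p.408 l.3–14, p.409 l.1–5, p.410 l.14–15, (3.34) p.396] -/
theorem localInverse_defect_laws_of_rows {parB : BondParY 𝔸 i} (hB : IsGaugeLawB i parB) (g : GaugeY 𝔸 i) (U V : CfgY 𝔸 i) (χ h : SiteY i → ℝ)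
    (D : Finset (FBondY i))
    (hχ : ∀ f : FBondY i, h (chartY i f.src) ≠ 0 → ∀ f', InStencilB i f f' → χ (chartY i f'.src) = 1)
    (hD : ∀ f f' : FBondY i, InStencilB i f f' → h (chartY i f'.src) ≠ 0 → f ∈ D) (hχD : ∀ f ∈ D, χ (chartY i f.src) = 1)
    (hrow : ∀ f : FBondY i, h (chartY i f.src) ≠ 0 → ∀ Λ, deltaLocY i parB (gaugeY i g U) Λ f = deltaLocY i parB V Λ f)
    (hrowD : ∀ f ∈ D, ∀ Λ, deltaLocY i parB (gaugeY i g U) (cutMulY (hBdY i h) Λ) f = deltaLocY i parB V (cutMulY (hBdY i h) Λ) f)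
    (hnear : ∀ f : FBondY i, h (chartY i f.src) ≠ 0 → ∀ Λ,
      QsY i parB V (aY i (QY i parB V Λ)) f = QsCubeY i c parB V (aCubeY i c (QCubeY i c parB V Λ)) f)
    (hnearT : ∀ (f : FBondY i) (Λ : FBondY i → 𝔸), QsY i parB V (aY i (QY i parB V (cutMulY (hBdY i h) Λ))) f =
      QsCubeY i c parB V (aCubeY i c (QCubeY i c parB V (cutMulY (hBdY i h) Λ))) f)
    (hunit : IsUnit (deltaACubeY i c parS parB V)) :
    cutMulY (hBdY i h) * (deltaLocY i parB U - locProjBY i c parS g V) * locLetterBY i c parS parB g χ V * cutMulY (hBdY i h) =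
        cutMulY (hBdY i h) * cutMulY (hBdY i h) - locDefectBY i c parS parB g χ h V ∧
      cutMulY (hBdY i h) * locLetterBY i c parS parB g χ V * (deltaLocY i parB U - locProjBY i c parS g V) * cutMulY (hBdY i h) =
        cutMulY (hBdY i h) * cutMulY (hBdY i h) - locDefectTBY i c parS parB g χ h V := by
  -- `supp h ⊂ D` (a bond is in its own input stencil), so `χ = 1` on `supp h`
  have hχh : ∀ z, χ z * h z = h z := by
    intro z
    by_cases hz : h z = 0
    · rw [hz, mul_zero]
    · -- pick a bond starting at `z` (direction `0`): its chart site is `z`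
      obtain ⟨x, hx⟩ := (Node00.OpsYNablaBridge.chartY i).surjective z
      have hf : h (chartY i (⟨x, ⟨0, hd⟩⟩ : FBondY i).src) ≠ 0 := by rw [show (⟨x, ⟨0, hd⟩⟩ : FBondY i).src = x from rfl, hx]; exact hz
      have := hχ _ hf _ (inStencilB_refl i _)
      rw [show (⟨x, ⟨0, hd⟩⟩ : FBondY i).src = x from rfl, hx] at this
      rw [this, one_mul]
  refine ⟨cutMulY_sub_locLetterBY_cutMulY i c parS hB g U V χ h hχh ?_ hunit, cutMulY_locLetterBY_sub_cutMulY i c parS hB g U V χ h hχh ?_ hunit⟩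
  · exact cutMulY_deltaLocY_cutMulY_eq i c parB (gaugeY i g U) V h χ hχ hrow hnear
  · exact cutMulY_deltaLocY_cutMulY_eq' i c parB (gaugeY i g U) V h χ D hD hχD hrowD hnearT

end Letter

/-! ## §5 At the partition of record `h_□ = hTY i □`: the member ∕ cube averaging-row agreement discharged -/

section Record

variable (i : KIdx d ℓ hd hL b₀ b₁) (c : ↥(cubes i.D.toDomains)) (parS : SiteParY 𝔸 i)

/-- ★★★ **`hP1`, `hdef`, `hdefT` OF THE CONSUMER FOR THE LOCALISED BOND LETTER AT `h_□ = hTY i □`**, in the shape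
`B9Thm310DeltaAIsUnitOfExpansion.eBlock_kernelFamilyBInv_GAY_of_localInverseCubes''` binds them (`Oc □ := fun _ => locLetterBY …`, U-constant; `Pl □ := locProjBY …`,
`P1l □ := locP1BY …`, `E □ := locDefectBY …`, `Et □ := locDefectTBY …`, all read at the background `cfg U₁ =: U`): from the gauge law of `parB`, `IsUnit Δ_{a,□}(Ṽ)`
(Cor 3.5's content, FILE G-F5), `χ = 1` on the input stencils of the `h_□`-rows and of `D ⊇` the rows meeting `supp h_□`, and the row agreement `Δ_loc(U^u) ↔ Δ_loc(Ṽ)`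
there (FILE G-F3 at the cut-offs of record); the member ∕ cube averaging rows agree near `□` by r05's `QsaQCubeY_apply_eq_of_hT` and this seat's
`QsaQCubeY_cutMulY_hT_apply_eq`.  DEFECT LABEL: `E_□`, `E♯_□` are (R)-design terms, NOT in print; `= 0` for print's `G_□` and for r05's un-cut `GACubeY`.
[cite: Balaban1985BackgroundPropagators, (3.105) p.414, (3.101) p.414, Cor. 3.6 p.408 l.3–14, p.409 l.1–5, p.410 l.14–15, (3.87) p.409, (3.34) p.396] -/
theorem localInverse_defect_laws_hTY {parB : BondParY 𝔸 i} (hB : IsGaugeLawB i parB) (g : GaugeY 𝔸 i) (U V : CfgY 𝔸 i) (χ : SiteY i → ℝ)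
    (D : Finset (FBondY i))
    (hχ : ∀ f : FBondY i, hTY i c (chartY i f.src) ≠ 0 → ∀ f', InStencilB i f f' → χ (chartY i f'.src) = 1)
    (hD : ∀ f f' : FBondY i, InStencilB i f f' → hTY i c (chartY i f'.src) ≠ 0 → f ∈ D) (hχD : ∀ f ∈ D, χ (chartY i f.src) = 1)
    (hrow : ∀ f : FBondY i, hTY i c (chartY i f.src) ≠ 0 → ∀ Λ, deltaLocY i parB (gaugeY i g U) Λ f = deltaLocY i parB V Λ f)
    (hrowD : ∀ f ∈ D, ∀ Λ, deltaLocY i parB (gaugeY i g U) (cutMulY (hBdY i (hTY i c)) Λ) f = deltaLocY i parB V (cutMulY (hBdY i (hTY i c)) Λ) f)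
    (hunit : IsUnit (deltaACubeY i c parS parB V)) :
    (locProjBY i c parS g V * cutMulY (hBdY i (hTY i c)) = cutMulY (hBdY i (hTY i c)) * locProjBY i c parS g V + locP1BY i c parS g (hTY i c) V) ∧
    cutMulY (hBdY i (hTY i c)) * (deltaLocY i parB U - locProjBY i c parS g V) * locLetterBY i c parS parB g χ V * cutMulY (hBdY i (hTY i c)) =
        cutMulY (hBdY i (hTY i c)) * cutMulY (hBdY i (hTY i c)) - locDefectBY i c parS parB g χ (hTY i c) V ∧
      cutMulY (hBdY i (hTY i c)) * locLetterBY i c parS parB g χ V * (deltaLocY i parB U - locProjBY i c parS g V) * cutMulY (hBdY i (hTY i c)) =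
        cutMulY (hBdY i (hTY i c)) * cutMulY (hBdY i (hTY i c)) - locDefectTBY i c parS parB g χ (hTY i c) V :=
  ⟨locProjBY_mul_cutMulY i c parS g (hTY i c) V,
    localInverse_defect_laws_of_rows i c parS hB g U V χ (hTY i c) D hχ hD hχD hrow hrowD
      (fun f hf Λ => (QsaQCubeY_apply_eq_of_hT i c parB V Λ f hf).symm) (fun f Λ => (QsaQCubeY_cutMulY_hT_apply_eq i c parB V Λ f).symm) hunit⟩

end Record

end Literature.MathematicalPhysics.QuantumFieldTheory.Balaban1983to89.B9Cor36GCubeLocLetter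

end
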